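import Literature.Analysis.FluidPDE.AxisymNoSwirlL1VorticityGlobalViscosity
import Literature.Analysis.FluidPDE.HyperbolicDSSOrbit
import HarnessLib

/-!
# Gallay–Šverák 2015, Theorem 1.1 with (1.10)–(1.12), transported to ARBITRARY viscosity `ν > 0`
# for GENERAL `L¹(Ω)` data: the scale-invariant estimates in the run's own time unit

Analysis/FluidPDE support file (all results proved; no new named fact). The tree's named fact
`GallaySverak2015.L1VorticityGlobalExistence` (`AxisymNoSwirlL1VorticityGlobal.lean`) renders
Gallay–Šverák 2015, Thm 1.1 + Rem. 4.6 + (1.10)–(1.12) at the paper's normalisation `ν = 1`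
(arXiv:1510.01036, §1, p. 3: "we assume throughout this paper that the kinematic viscosity and the
fluid density are both equal to `1`"). `AxisymNoSwirlL1VorticityGlobalViscosity.lean` (cell
`pub/ns-blowup`, HARVEST-MAP C25) supplies the change of time unit for classical solutions
(`IsClassicalNSSolutionOn.timeRescale_viscosity_Ioi`: `u(s) = ν u′(ν s)`, `p(s) = ν² p′(ν s)`),
the homogeneity of the `L¹(Ω)` norm (`GallaySverak2015.l1OmegaNorm_const_smul`) and the
SMOOTH-DATUM corollary at every `ν > 0`
(`GallaySverak2015.L1VorticityGlobalExistence.of_noSwirlDatum_viscosity`).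

This file transports the WHOLE rendered statement — general datum `ω₀ = ω₀^θ e_θ`,
`ω₀^θ ∈ L¹(Ω)` (possibly of infinite energy), and every clause of the conclusion including the
quantitative bounds — to viscosity `ν`, with the constants in Gallay–Šverák's dimensionless
variable `‖ω₀‖_{L¹(Ω)}/ν` (both `‖ω_θ‖_{L¹(Ω)} = ∫_Ω |ω_θ| dr dz` and `ν` have dimension
`length²/time`):

* `GallaySverak2015.L1VorticityGlobalExistence.viscosity`: with the SAME function `C` as the fact
  (`C(s) ≤ K s` on some `[0, δ]`), for every `ν > 0` and every admissible datum there is a global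
  classical solution `(u, p)` of Navier–Stokes with viscosity `ν` on `(0, ∞) × ℝ³`, axisymmetric
  without swirl, `u(t) = BS[ω(t)]`, `‖ω_θ(t)‖_{L¹(Ω)} ≤ ‖ω₀‖_{L¹(Ω)}`, `ω(t)` bounded, attaining
  `ω₀` in `L¹(Ω)` and `L¹(Ω)`-continuous at positive times, with
  `t ‖ω(t, x)‖ ≤ C(‖ω₀‖_{L¹(Ω)}/ν)` ((1.11) at viscosity `ν`),
  `√t ‖u(t, x)‖ ≤ √ν · C(‖ω₀‖_{L¹(Ω)}/ν)` ((1.12) at viscosity `ν`), and (1.10) for `p = ∞` at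
  `t → 0⁺` and `t → ∞` and for `p = 1` at `t → ∞`. Proof: apply the `ν = 1` statement to the
  datum `ν⁻¹ ω₀` (admissible, `‖ν⁻¹ω₀‖_{L¹(Ω)} = ν⁻¹‖ω₀‖_{L¹(Ω)}`) and set `u(t) = ν u′(ν t)`:
  then `ω(t) = ν ω′(ν t)` (`curl_const_smul_field`), `BS[ν ω′] = ν BS[ω′]` (`biotSavart_smul`),
  `t ‖ω(t,x)‖ = (ν t) ‖ω′(ν t, x)‖`, `√t ‖u(t,x)‖ = √ν · √(ν t) ‖u′(ν t, x)‖`, and the time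
  windows / limits move along `t ↦ ν t`.
* `GallaySverak2015.L1VorticityGlobalExistence.not_vorticityBlowsUpAt_viscosity`: the
  general-datum twin, at viscosity `ν`, of the tree's `…not_vorticityBlowsUpAt` (`ν = 1`) and of
  `…of_noSwirlDatum_viscosity` (smooth datum): no vorticity blow-up at any positive time.

Consumers: quantitative citers of (1.11)/(1.12) at the run's own `ν` (cell `pub/ns-blowup`,
19249 negative lane; profile zone Z6 ν-axis).

## What this is NOT

Not a discharge of `GallaySverak2015.L1VorticityGlobalExistence` (it stays a hypothesis
`(h : …)`); no uniqueness, no identification with Leray / Kato solutions from a velocity datum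
(not rendered by the fact either); nothing about data with swirl; not a statement about the Euler
problem (`ν = 0`), for which data of this class blow up (`AxisymNoSwirlHolderThreshold.lean`).

## References

* Th. Gallay, V. Šverák, *Remarks on the Cauchy problem for the axisymmetric Navier–Stokes
  equations*, Confluentes Math. 7 (2015) 67–92 = arXiv:1510.01036 `[GallaySverak2016]`: §1 p. 3
  (normalisation `ν = 1`), Thm. 1.1 with (1.10)–(1.12) (p. 4), Rem. 4.6 (p. 15), Rem. 5.4
  (p. 17); held text `paper:arxiv-1510.01036`, chunks p0003–p0004.
* T. Tao, *Localisation and compactness properties of the Navier–Stokes global regularity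
  problem*, Anal. PDE 6 (2013), footnote 3 (viscosity rescaling). `[Tao2011]`
-/

noncomputable section

open MeasureTheory Set Function Filter
open _root_.Topology
open scoped NNReal ENNReal

namespace Literature.Analysis.FluidPDE

namespace GallaySverak2015

/-! ### Scaling bookkeeping for the datum class and the slices -/

/-- **The datum class of Theorem 1.1 is a cone**: if `ω₀ = ω₀^θ e_θ` is an admissible
Gallay–Šverák datum (a.e.-strongly measurable, axisymmetric, zero radial and axial parts), so is
`a ω₀` for every real `a`. [cite: GallaySverak2016, Thm. 1.1 hypothesis ω₀ ∈ L¹(Ω) (arXiv p. 4)] -/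
theorem datum_const_smul {ω₀ : EuclideanSpace ℝ (Fin 3) → EuclideanSpace ℝ (Fin 3)} (a : ℝ)
    (hm : AEStronglyMeasurable ω₀ volume) (hax : IsAxisymmetric ω₀)
    (hrad : ∀ x, x 0 * ω₀ x 0 + x 1 * ω₀ x 1 = 0) (haxial : ∀ x, ω₀ x 2 = 0) :
    AEStronglyMeasurable (fun x => a • ω₀ x) volume ∧ IsAxisymmetric (fun x => a • ω₀ x) ∧
      (∀ x, x 0 * (a • ω₀ x) 0 + x 1 * (a • ω₀ x) 1 = 0) ∧ (∀ x, (a • ω₀ x) 2 = 0) := by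
  refine ⟨hm.const_smul a, hax.const_smul a, fun x => ?_, fun x => ?_⟩
  · have h := hrad x
    simp only [PiLp.smul_apply, smul_eq_mul]
    linear_combination a * h
  · simp only [PiLp.smul_apply, smul_eq_mul, haxial x, mul_zero]

/-- For `ν > 0`, `t ↦ ν t` maps right neighbourhoods of `0` to right neighbourhoods of `0`
(the time unit change `s = ν t` near the initial time; file-internal plumbing). [folklore] -/
private theorem tendsto_const_mul_nhdsGT_zero {ν : ℝ} (hν : 0 < ν) :
    Tendsto (fun t : ℝ => ν * t) (𝓝[>] 0) (𝓝[>] 0) := by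
  have hmaps : MapsTo (fun t : ℝ => ν * t) (Ioi 0) (Ioi 0) := fun t ht => mul_pos hν ht
  have hcont : ContinuousWithinAt (fun t : ℝ => ν * t) (Ioi 0) 0 :=
    (continuous_const_mul ν).continuousWithinAt
  have h := hcont.tendsto_nhdsWithin hmaps
  rwa [mul_zero] at h

/-- The vorticity of the rescaled slice: `curl (ν u′(ν t)) = ν curl (u′(ν t))`
(`curl_const_smul_field`, no differentiability needed) — the vorticity side of the paper's
normalisation `ν = 1` (§1 p. 3), undone by `u(t) = ν u′(ν t)`. [cite: GallaySverak2016, §1 (arXiv p. 3): ν = 1 normalisation] -/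
theorem curl_timeRescale_apply (ν : ℝ)
    (u' : ℝ → EuclideanSpace ℝ (Fin 3) → EuclideanSpace ℝ (Fin 3)) (t : ℝ)
    (x : EuclideanSpace ℝ (Fin 3)) :
    curl (timeRescale ν ν u' t) x = ν • curl (u' (ν * t)) x := by
  rw [timeRescale_slice, curl_const_smul_field]

/-- The vorticity of the rescaled slice as a function: `curl (ν u′(ν t)) = ν • curl (u′(ν t))`
(the paper's normalisation `ν = 1`, §1 p. 3, undone by `u(t) = ν u′(ν t)`). [cite: GallaySverak2016, §1 (arXiv p. 3): ν = 1 normalisation] -/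
theorem curl_timeRescale (ν : ℝ)
    (u' : ℝ → EuclideanSpace ℝ (Fin 3) → EuclideanSpace ℝ (Fin 3)) (t : ℝ) :
    curl (timeRescale ν ν u' t) = fun x => ν • curl (u' (ν * t)) x :=
  funext (curl_timeRescale_apply ν u' t)

/-- `‖ω_θ‖_{L¹(Ω)}` of the rescaled slice: `‖curl (ν u′(ν t))‖_{L¹(Ω)} = ν ‖curl u′(ν t)‖_{L¹(Ω)}`
for `ν ≥ 0`. [cite: GallaySverak2016, (1.5) (arXiv p. 4)] -/
theorem l1OmegaNorm_curl_timeRescale {ν : ℝ} (hν : 0 ≤ ν)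
    (u' : ℝ → EuclideanSpace ℝ (Fin 3) → EuclideanSpace ℝ (Fin 3)) (t : ℝ) :
    l1OmegaNorm (curl (timeRescale ν ν u' t)) =
      ENNReal.ofReal ν * l1OmegaNorm (curl (u' (ν * t))) := by
  rw [curl_timeRescale, l1OmegaNorm_const_smul, Real.enorm_eq_ofReal hν]

/-- `‖·‖_{L¹(Ω)}` of a difference of rescaled vorticities:
`‖ν ω′(ν t) − ν w‖_{L¹(Ω)} = ν ‖ω′(ν t) − w‖_{L¹(Ω)}` (used for the attainment of the datum,
`w = ν⁻¹ ω₀`, and for the `L¹(Ω)`-continuity, `w = ω′(ν t₀)`). [cite: GallaySverak2016, (1.5) (arXiv p. 4)] -/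
theorem l1OmegaNorm_curl_timeRescale_sub {ν : ℝ} (hν : 0 ≤ ν)
    (u' : ℝ → EuclideanSpace ℝ (Fin 3) → EuclideanSpace ℝ (Fin 3)) (t : ℝ)
    (w : EuclideanSpace ℝ (Fin 3) → EuclideanSpace ℝ (Fin 3)) :
    l1OmegaNorm (fun x => curl (timeRescale ν ν u' t) x - ν • w x) =
      ENNReal.ofReal ν * l1OmegaNorm (fun x => curl (u' (ν * t)) x - w x) := by
  have e : (fun x => curl (timeRescale ν ν u' t) x - ν • w x) =
      fun x => ν • (curl (u' (ν * t)) x - w x) := by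
    funext x
    rw [curl_timeRescale_apply, smul_sub]
  rw [e, l1OmegaNorm_const_smul, Real.enorm_eq_ofReal hν]

/-! ### The statement at viscosity `ν` -/

/-- **Gallay–Šverák 2015, Theorem 1.1 with Remark 4.6 and (1.10)–(1.12), at every viscosity
`ν > 0`** (the ν-general form of the named fact `L1VorticityGlobalExistence`, which is the case
`ν = 1` as printed: "we assume throughout this paper that the kinematic viscosity and the fluid
density are both equal to `1`", §1 p. 3; still CONDITIONAL on that fact). With the SAME function
`C` as the fact (`C(s) ≤ K s` on some `[0, δ]`): for every `ν > 0` and every azimuthal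
axisymmetric a.e.-strongly measurable datum `ω₀` with `‖ω₀^θ‖_{L¹(Ω)} < ∞` there is a classical
solution `(u, p)` of Navier–Stokes with viscosity `ν` (`f = 0`) on `(0, ∞) × ℝ³`, axisymmetric
without swirl, with `u(t) = BS[ω(t)]`, `ω(t) = curl u(t)` bounded and
`‖ω_θ(t)‖_{L¹(Ω)} ≤ ‖ω₀‖_{L¹(Ω)}` for `t > 0`, `ω(t) → ω₀` in `L¹(Ω)` as `t → 0⁺`, `t ↦ ω(t)`
continuous in `L¹(Ω)` on `(0, ∞)`, the scale-invariant bounds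
`t ‖ω(t, x)‖ ≤ C(‖ω₀‖_{L¹(Ω)}/ν)` ((1.11)) and `√t ‖u(t, x)‖ ≤ √ν · C(‖ω₀‖_{L¹(Ω)}/ν)` ((1.12)),
`t · sup ‖ω(t)‖ → 0` as `t → 0⁺` and as `t → ∞`, and `‖ω_θ(t)‖_{L¹(Ω)} → 0` as `t → ∞`
((1.10), `p = ∞` and `p = 1`). Proof: the `ν = 1` statement for the datum `ν⁻¹ ω₀`
(`datum_const_smul`, `‖ν⁻¹ ω₀‖_{L¹(Ω)} = ν⁻¹ ‖ω₀‖_{L¹(Ω)}` by `l1OmegaNorm_const_smul`) and the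
change of time unit `u(t) = ν u′(ν t)`, `p(t) = ν² p′(ν t)`
(`IsClassicalNSSolutionOn.timeRescale_viscosity_Ioi`); every clause is transported along
`t ↦ ν t` (`curl_timeRescale`, `biotSavart_smul`, `l1OmegaNorm_curl_timeRescale(_sub)`).
[cite: GallaySverak2016, Thm. 1.1 with (1.10)–(1.12) (arXiv p. 4) and §1 p. 3 (ν = 1 normalisation); Rem. 4.6 (p. 15)] -/
theorem L1VorticityGlobalExistence.viscosity (h : L1VorticityGlobalExistence) :
    ∃ C : ℝ → ℝ, (∃ K δ : ℝ, 0 < δ ∧ ∀ s, 0 ≤ s → s ≤ δ → C s ≤ K * s) ∧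
    ∀ ν : ℝ, 0 < ν → ∀ ω₀ : EuclideanSpace ℝ (Fin 3) → EuclideanSpace ℝ (Fin 3),
      AEStronglyMeasurable ω₀ volume → IsAxisymmetric ω₀ →
      (∀ x, x 0 * ω₀ x 0 + x 1 * ω₀ x 1 = 0) → (∀ x, ω₀ x 2 = 0) → l1OmegaNorm ω₀ < ⊤ →
      ∃ (u : ℝ → EuclideanSpace ℝ (Fin 3) → EuclideanSpace ℝ (Fin 3))
        (p : ℝ → EuclideanSpace ℝ (Fin 3) → ℝ),
        -- smooth for positive times, Navier–Stokes with viscosity ν classically, global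
        IsClassicalNSSolutionOn (Ioi 0) ν 0 u p ∧
        -- axisymmetric without swirl; velocity = Biot–Savart of its vorticity; ω(t) ∈ L¹ ∩ L^∞(Ω)
        (∀ t, 0 < t → IsAxisymmetric (u t) ∧ HasNoSwirl (u t) ∧ u t = biotSavart (curl (u t)) ∧
          l1OmegaNorm (curl (u t)) ≤ l1OmegaNorm ω₀ ∧ ∃ B : ℝ, ∀ x, ‖curl (u t) x‖ ≤ B) ∧
        -- the datum is attained in L¹(Ω), and t ↦ ω_θ(t) is continuous in L¹(Ω) on (0, ∞)
        Tendsto (fun t => l1OmegaNorm (fun x => curl (u t) x - ω₀ x)) (𝓝[>] 0) (𝓝 0) ∧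
        (∀ t₀, 0 < t₀ →
          Tendsto (fun t => l1OmegaNorm (fun x => curl (u t) x - curl (u t₀) x)) (𝓝 t₀) (𝓝 0)) ∧
        -- (1.11) and (1.12) at viscosity ν, in the dimensionless variable ‖ω₀‖_{L¹(Ω)}/ν
        (∀ t, 0 < t → ∀ x, t * ‖curl (u t) x‖ ≤ C ((l1OmegaNorm ω₀).toReal / ν) ∧
          Real.sqrt t * ‖u t x‖ ≤ Real.sqrt ν * C ((l1OmegaNorm ω₀).toReal / ν)) ∧
        -- (1.10), p = ∞, at t → 0⁺ and at t → ∞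
        (∀ ε, 0 < ε → ∃ δ, 0 < δ ∧ ∀ t, 0 < t → t < δ → ∀ x, t * ‖curl (u t) x‖ ≤ ε) ∧
        (∀ ε, 0 < ε → ∃ R, ∀ t, R < t → ∀ x, t * ‖curl (u t) x‖ ≤ ε) ∧
        -- (1.10), p = 1, at t → ∞
        Tendsto (fun t => l1OmegaNorm (curl (u t))) atTop (𝓝 0) := by
  obtain ⟨C, hCK, hC⟩ := h
  refine ⟨C, hCK, fun ν hν ω₀ hm hax hrad haxial hL1 => ?_⟩
  have hν0 : ν ≠ 0 := hν.ne'
  have hνinv : 0 ≤ ν⁻¹ := inv_nonneg.2 hν.le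
  -- the rescaled datum `ν⁻¹ ω₀` is admissible, with `‖ν⁻¹ ω₀‖_{L¹(Ω)} = ν⁻¹ ‖ω₀‖_{L¹(Ω)}`
  obtain ⟨hm₁, hax₁, hrad₁, haxial₁⟩ := datum_const_smul ν⁻¹ hm hax hrad haxial
  have hnorm₁ : l1OmegaNorm (fun x => ν⁻¹ • ω₀ x) = ENNReal.ofReal ν⁻¹ * l1OmegaNorm ω₀ := by
    rw [l1OmegaNorm_const_smul, Real.enorm_eq_ofReal hνinv]
  have hL1₁ : l1OmegaNorm (fun x => ν⁻¹ • ω₀ x) < ⊤ := by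
    rw [hnorm₁]
    exact ENNReal.mul_lt_top ENNReal.ofReal_lt_top hL1
  have hM₁ : (l1OmegaNorm (fun x => ν⁻¹ • ω₀ x)).toReal = (l1OmegaNorm ω₀).toReal / ν := by
    rw [hnorm₁, ENNReal.toReal_mul, ENNReal.toReal_ofReal hνinv, inv_mul_eq_div]
  have hω₀ : ∀ x, ω₀ x = ν • (ν⁻¹ • ω₀ x) := fun x => by
    rw [smul_smul, mul_inv_cancel₀ hν0, one_smul]
  -- the unit-viscosity solution from the rescaled datum
  obtain ⟨u', p', hns, hsym, h0, hcont, hbd, hsmall, hlarge, hdecay⟩ :=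
    hC (fun x => ν⁻¹ • ω₀ x) hm₁ hax₁ hrad₁ haxial₁ hL1₁
  rw [hM₁] at hbd
  -- the rescaled pair `u(t) = ν u′(ν t)`, `p(t) = ν² p′(ν t)`
  refine ⟨timeRescale ν ν u', timeRescale ν (ν ^ 2) p', hns.timeRescale_viscosity_Ioi hν,
    ?_, ?_, ?_, ?_, ?_, ?_, ?_⟩
  · -- symmetry, Biot–Savart, L¹(Ω) bound, boundedness of the slices at t > 0
    intro t ht
    have hνt : 0 < ν * t := mul_pos hν ht
    obtain ⟨hax', hsw', hBS, hL1le, B, hB⟩ := hsym (ν * t) hνt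
    refine ⟨?_, ?_, ?_, ?_, ν * B, fun x => ?_⟩
    · rw [timeRescale_slice]
      exact hax'.const_smul ν
    · rw [timeRescale_slice]
      exact hsw'.const_smul ν
    · -- `ν u′(ν t) = ν BS[ω′(ν t)] = BS[ν ω′(ν t)] = BS[curl (ν u′(ν t))]`
      rw [curl_timeRescale, show (fun x => ν • curl (u' (ν * t)) x) = ν • curl (u' (ν * t))
        from rfl, biotSavart_smul, ← hBS, timeRescale_slice]
      rfl
    · rw [l1OmegaNorm_curl_timeRescale hν.le]
      calc ENNReal.ofReal ν * l1OmegaNorm (curl (u' (ν * t)))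
          ≤ ENNReal.ofReal ν * l1OmegaNorm (fun x => ν⁻¹ • ω₀ x) := by gcongr
        _ = l1OmegaNorm ω₀ := by
          rw [hnorm₁, ← mul_assoc, ← ENNReal.ofReal_mul hν.le, mul_inv_cancel₀ hν0,
            ENNReal.ofReal_one, one_mul]
    · rw [curl_timeRescale_apply, norm_smul, Real.norm_eq_abs, abs_of_pos hν]
      exact mul_le_mul_of_nonneg_left (hB x) hν.le
  · -- attainment of the datum in L¹(Ω): ‖ω(t) − ω₀‖ = ν ‖ω′(ν t) − ν⁻¹ω₀‖, and ν t → 0⁺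
    have hF : ∀ t, l1OmegaNorm (fun x => curl (timeRescale ν ν u' t) x - ω₀ x) =
        ENNReal.ofReal ν * l1OmegaNorm (fun x => curl (u' (ν * t)) x - ν⁻¹ • ω₀ x) := by
      intro t
      rw [← l1OmegaNorm_curl_timeRescale_sub hν.le u' t (fun x => ν⁻¹ • ω₀ x)]
      congr 1
      funext x
      rw [← hω₀ x]
    have lim := ENNReal.Tendsto.const_mul (a := ENNReal.ofReal ν)
      (h0.comp (tendsto_const_mul_nhdsGT_zero hν)) (Or.inr ENNReal.ofReal_ne_top)
    rw [mul_zero] at lim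
    exact lim.congr fun t => (hF t).symm
  · -- L¹(Ω)-continuity at t₀ > 0: ‖ω(t) − ω(t₀)‖ = ν ‖ω′(ν t) − ω′(ν t₀)‖, and ν t → ν t₀
    intro t₀ ht₀
    have hνt₀ : 0 < ν * t₀ := mul_pos hν ht₀
    have hF : ∀ t, l1OmegaNorm (fun x => curl (timeRescale ν ν u' t) x -
        curl (timeRescale ν ν u' t₀) x) =
        ENNReal.ofReal ν * l1OmegaNorm (fun x => curl (u' (ν * t)) x - curl (u' (ν * t₀)) x) := by
      intro t
      rw [← l1OmegaNorm_curl_timeRescale_sub hν.le u' t (curl (u' (ν * t₀)))]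
      congr 1
      funext x
      rw [curl_timeRescale_apply ν u' t₀ x]
    have hmul : Tendsto (fun t : ℝ => ν * t) (𝓝 t₀) (𝓝 (ν * t₀)) :=
      ((continuous_const_mul ν).tendsto t₀)
    have lim := ENNReal.Tendsto.const_mul (a := ENNReal.ofReal ν)
      ((hcont (ν * t₀) hνt₀).comp hmul) (Or.inr ENNReal.ofReal_ne_top)
    rw [mul_zero] at lim
    exact lim.congr fun t => (hF t).symm
  · -- (1.11) and (1.12): t‖ω(t,x)‖ = (ν t)‖ω′(ν t, x)‖, √t‖u(t,x)‖ = √ν · √(ν t)‖u′(ν t, x)‖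
    intro t ht x
    have hνt : 0 < ν * t := mul_pos hν ht
    obtain ⟨h1, h2⟩ := hbd (ν * t) hνt x
    constructor
    · rw [curl_timeRescale_apply, norm_smul, Real.norm_eq_abs, abs_of_pos hν]
      calc t * (ν * ‖curl (u' (ν * t)) x‖) = ν * t * ‖curl (u' (ν * t)) x‖ := by ring
        _ ≤ C ((l1OmegaNorm ω₀).toReal / ν) := h1
    · rw [timeRescale_apply, norm_smul, Real.norm_eq_abs, abs_of_pos hν]
      have hνs : Real.sqrt ν * Real.sqrt ν = ν := Real.mul_self_sqrt hν.le
      have key : Real.sqrt t * (ν * ‖u' (ν * t) x‖) =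
          Real.sqrt ν * (Real.sqrt (ν * t) * ‖u' (ν * t) x‖) := by
        rw [Real.sqrt_mul hν.le t]
        calc Real.sqrt t * (ν * ‖u' (ν * t) x‖)
            = Real.sqrt ν * Real.sqrt ν * Real.sqrt t * ‖u' (ν * t) x‖ := by rw [hνs]; ring
          _ = Real.sqrt ν * (Real.sqrt ν * Real.sqrt t * ‖u' (ν * t) x‖) := by ring
      rw [key]
      exact mul_le_mul_of_nonneg_left h2 (Real.sqrt_nonneg ν)
  · -- (1.10), p = ∞, t → 0⁺: the window (0, δ) for u′ becomes (0, δ/ν) for u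
    intro ε hε
    obtain ⟨δ, hδ, hδb⟩ := hsmall ε hε
    refine ⟨δ / ν, div_pos hδ hν, fun t ht htδ x => ?_⟩
    have hνt : 0 < ν * t := mul_pos hν ht
    have hνtδ : ν * t < δ := by rwa [lt_div_iff₀ hν, mul_comm] at htδ
    rw [curl_timeRescale_apply, norm_smul, Real.norm_eq_abs, abs_of_pos hν]
    calc t * (ν * ‖curl (u' (ν * t)) x‖) = ν * t * ‖curl (u' (ν * t)) x‖ := by ring
      _ ≤ ε := hδb (ν * t) hνt hνtδ x
  · -- (1.10), p = ∞, t → ∞: the window (R, ∞) for u′ becomes (R/ν, ∞) for u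
    intro ε hε
    obtain ⟨R, hR⟩ := hlarge ε hε
    refine ⟨R / ν, fun t hRt x => ?_⟩
    have hνt : R < ν * t := by rwa [div_lt_iff₀ hν, mul_comm] at hRt
    rw [curl_timeRescale_apply, norm_smul, Real.norm_eq_abs, abs_of_pos hν]
    calc t * (ν * ‖curl (u' (ν * t)) x‖) = ν * t * ‖curl (u' (ν * t)) x‖ := by ring
      _ ≤ ε := hR (ν * t) hνt x
  · -- (1.10), p = 1, t → ∞: ‖ω_θ(t)‖_{L¹(Ω)} = ν ‖ω′_θ(ν t)‖_{L¹(Ω)}, and ν t → ∞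
    have hmul : Tendsto (fun t : ℝ => ν * t) atTop atTop := tendsto_id.const_mul_atTop hν
    have lim := ENNReal.Tendsto.const_mul (a := ENNReal.ofReal ν) (hdecay.comp hmul)
      (Or.inr ENNReal.ofReal_ne_top)
    rw [mul_zero] at lim
    exact lim.congr fun t => (l1OmegaNorm_curl_timeRescale hν.le u' t).symm

/-- **No vorticity blow-up at any positive time, at viscosity `ν > 0`, for GENERAL `L¹(Ω)` data**
(the general-datum twin of `L1VorticityGlobalExistence.of_noSwirlDatum_viscosity` and the
viscosity-`ν` twin of `L1VorticityGlobalExistence.not_vorticityBlowsUpAt`): from (1.11) at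
viscosity `ν`, `‖ω(t, x)‖ ≤ C(‖ω₀‖_{L¹(Ω)}/ν)/t ≤ 2C/T` on `(T/2, T)`, so `VorticityBlowsUpAt u T`
fails for every `T > 0`. [cite: GallaySverak2016, (1.11) (arXiv p. 4) with §1 p. 3 (ν = 1 normalisation)] -/
theorem L1VorticityGlobalExistence.not_vorticityBlowsUpAt_viscosity (h : L1VorticityGlobalExistence)
    {ν : ℝ} (hν : 0 < ν)
    {ω₀ : EuclideanSpace ℝ (Fin 3) → EuclideanSpace ℝ (Fin 3)} (hm : AEStronglyMeasurable ω₀ volume)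
    (hax : IsAxisymmetric ω₀) (hrad : ∀ x, x 0 * ω₀ x 0 + x 1 * ω₀ x 1 = 0) (haxial : ∀ x, ω₀ x 2 = 0)
    (hL1 : l1OmegaNorm ω₀ < ⊤) :
    ∃ (u : ℝ → EuclideanSpace ℝ (Fin 3) → EuclideanSpace ℝ (Fin 3))
      (p : ℝ → EuclideanSpace ℝ (Fin 3) → ℝ),
      IsClassicalNSSolutionOn (Ioi 0) ν 0 u p ∧
      (∀ t, 0 < t → IsAxisymmetric (u t) ∧ HasNoSwirl (u t)) ∧
      Tendsto (fun t => l1OmegaNorm (fun x => curl (u t) x - ω₀ x)) (𝓝[>] 0) (𝓝 0) ∧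
      ∀ T, 0 < T → ¬ VorticityBlowsUpAt u T := by
  obtain ⟨C, -, hC⟩ := h.viscosity
  obtain ⟨u, p, hns, hsym, h0, -, hbd, -, -, -⟩ := hC ν hν ω₀ hm hax hrad haxial hL1
  refine ⟨u, p, hns, fun t ht => ⟨(hsym t ht).1, (hsym t ht).2.1⟩, h0, fun T hT hblow => ?_⟩
  set M : ℝ := C ((l1OmegaNorm ω₀).toReal / ν) with hM
  -- on (T/2, T) the vorticity is bounded by 2 M / T
  obtain ⟨t, ⟨x, hx⟩, ht⟩ := ((hblow (2 * M / T)).and_eventually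
    (Ioo_mem_nhdsLT (show T / 2 < T by linarith))).exists
  have ht0 : 0 < t := by linarith [ht.1]
  have h1 : t * ‖curl (u t) x‖ ≤ M := (hbd t ht0 x).1
  have h2 : T / 2 * ‖curl (u t) x‖ ≤ t * ‖curl (u t) x‖ :=
    mul_le_mul_of_nonneg_right ht.1.le (norm_nonneg _)
  have h3 : 2 * M / T < ‖curl (u t) x‖ := hx
  have h4 : 2 * M / T * (T / 2) = M := by field_simp
  nlinarith [mul_lt_mul_of_pos_right h3 (show 0 < T / 2 by linarith)]

end GallaySverak2015

end Literature.Analysis.FluidPDE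

end
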